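import Summits.HodgeConjecture.HodgeConjecture.Theorems.MarkmanPartnerTransportK3Sq2PeriodDatum
import Summits.HodgeConjecture.HodgeConjecture.Theorems.MarkmanPartnerTransportPicardThreeK3SquaresOneCycleDegree
import Literature.AlgebraicGeometry.Motives.HodgeStructureK3TypeOddRank

/-!
# Route MarkmanPartnerTransport · crux #5 `LowPicardRealMultiplication` — ONE CYCLE SUFFICES on the
# `X` side: one Hodge endomorphism of `H²(X)` with an irrational `(2,0)`-eigenvalue generates
# `End_Hdg(T(X)_ℚ)`, or `X` has complex multiplication

`X`-side counterpart of `…PicardThreeK3SquaresOneCycle` (K3 surfaces), run on the period datum of a marked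
smooth projective `K3^{[2]}`-type fourfold (`…K3Sq2PeriodDatum`: `T(X)_ℚ` with its irreducible polarized
Hodge structure of K3 type on the tree's abstract carriers; Zarhin: `E = End_Hdg(T(X)_ℚ)` is a number field
with the `(2,0)`-eigenvalue embedding `ε`; `dim_ℚ T(X)_ℚ = 23 − ρ(X)`). Given ONE rational, type-preserving
endomorphism `e` of `H²(X(ℂ); ℂ)` with `e σ = ev · σ` on `σ = φ⁻¹ z`: `e|_T ∈ E` with `ε(e|_T) = ev`. The
engine `generatedBy_or_cm_of_criterion` takes an abstract generation criterion ("`E = ℚ[r]` whenever `E` is a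
totally real field, `ε r = ev` and `dim V + ρ(X) = 23`") and returns: EITHER every rational Hodge endomorphism
of `H²(X)` killing `N¹(X)` with image `q`-orthogonal to `N¹(X)` is a rational polynomial in `e` on `T(X)` —
LITERALLY the hypothesis `hgen` of the `X`-side F4 `hodgeConjectureFor_of_cycleInducedGenerator` — OR `X`
has complex multiplication (a rational endomorphism preserving type `(1,1)` with a non-real eigenvalue on
`σ`; Zarhin's adjoint theorem) AND `ρ(X)` is odd (at even `ρ(X)`, `dim T = 23 − ρ(X)` is odd and `E` is
totally real, Huybrechts Rem. 3.3.14 (ii) — so at `ρ(X) = 2` the first alternative holds outright). The two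
instances: prime form (`ev ∉ ℚ`, `d · m + ρ(X) = 23 ⇒ d` prime —
automatic at `ρ(X) ∈ {1, 2}`: `22 = 2·11`, `21 = 3·7`) and degree form (`deg minpoly(ev) = k`,
`k·j·m + ρ(X) ≠ 23`). No definition, no sorry; no named-fact hypothesis (Zarhin, van Geemen, Lefschetz
`(1,1)` are tree theorems). Prover seat hodge-nonav-19652-p1 (gen 8), `--supports stmt-HodgeConjecture-19653`.
Nothing here proves the crux or HC; the sequel `…K3Sq2OneCycleHodge` draws HC⁴(X) from one algebraic cycle.

References: van Geemen, Michigan Math. J. 56 (2008) Lemma 3.2; Zarhin, J. reine angew. Math. 341 (1983)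
Thm. 1.5.1, Thm. 1.6; Huybrechts, *Lectures on K3 Surfaces*, Ch. 3 Lemma 3.3.1, Thm. 3.3.7; van Geemen–Schütt,
Forum Math. Sigma 13 (2025) e2, §2.1.
-/

noncomputable section

set_option linter.dupNamespace false

open scoped TensorProduct
open Module CategoryTheory Polynomial
open Literature.AlgebraicTopology.SingularHomology Literature.Geometry.Kaehler
open Literature.AlgebraicGeometry Literature.AlgebraicGeometry.Motives Literature.AlgebraicGeometry.HodgeTheory
open Literature.AlgebraicGeometry.Motives.HodgeStructure
open Literature.AlgebraicGeometry.Hyperkaehler Literature.AlgebraicGeometry.Surfaces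
open Summit.HodgeConjecture.HodgeConjecture.Theorems.NikulinTwinTransport
open Summit.HodgeConjecture.HodgeConjecture.Theorems.MarkmanPartnerTransport.BBFPositivity
open Summit.HodgeConjecture.HodgeConjecture.Theorems.MarkmanPartnerTransport.LatticeBridge

namespace Summit.HodgeConjecture.HodgeConjecture.Theorems.MarkmanPartnerTransport.PartnerLattice

/-- `MarkedK3Sq[X, φ, P, z]`: VERBATIM the `let MarkedK3Sq := …` binder of the route declarations of
MarkmanPartnerTransport (clauses (m1)–(m6)). Local notation only. -/
local notation3 (prettyPrint := false) "MarkedK3Sq[" X ", " φ ", " P ", " z "]" =>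
  (((IsIntegralClass P ∧ ∀ Q : complexBetti X (2 * 4), IsIntegralClass Q → ∃ n : ℤ, Q = n • P) ∧
    (∀ c : complexBetti X 2, IsIntegralClass c ↔ ∃ v : K3HilbertIndex → ℤ, φ c = fun i => (v i : ℂ)) ∧
    (∀ a : complexBetti X 2, cupPowTwo a 4 = ((3 : ℂ) * (k3HilbertForm 2 (φ a) (φ a)) ^ 2) • P) ∧
    (IsOfHodgeType 4 X 2 2 0 (LinearEquiv.symm φ z) ∧
      ∀ τ : complexBetti X 2, IsOfHodgeType 4 X 2 2 0 τ → ∃ t : ℂ, τ = t • LinearEquiv.symm φ z) ∧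
    (∀ c : complexBetti X 2, IsOfHodgeType 4 X 2 1 1 c ↔
      (k3HilbertForm 2 (φ c) z = 0 ∧ k3HilbertForm 2 (φ c) (star z) = 0)) ∧
    (k3HilbertForm 2 z z = 0 ∧ 0 < (k3HilbertForm 2 (star z) z).re)))

/-- `GenX[X, φ, e]`: "every rational Hodge endomorphism of `H²(X)` killing `N¹(X)` with image `q`-orthogonal
to `N¹(X)` is a rational polynomial in `e` on `T(X)`" — VERBATIM the hypothesis `hgen` of
`hodgeConjectureFor_of_cycleInducedGenerator`. Local notation only. -/
local notation3 (prettyPrint := false) "GenX[" X ", " φ ", " e "]" =>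
  (∀ f : complexBetti X 2 →ₗ[ℂ] complexBetti X 2, (∀ y, IsRationalClass y → IsRationalClass (f y)) →
      (∀ (i j : ℕ) y, IsOfHodgeType 4 X 2 i j y → IsOfHodgeType 4 X 2 i j (f y)) →
      (∀ d : complexBetti X 2, d ∈ algebraicClasses X 1 → f d = 0) →
      (∀ y : complexBetti X 2, ∀ d : complexBetti X 2, d ∈ algebraicClasses X 1 →
        k3HilbertForm 2 (φ (f y)) (φ d) = 0) →
      ∃ (n : ℕ) (a : Fin n → ℚ), ∀ y : complexBetti X 2,
        (∀ d : complexBetti X 2, d ∈ algebraicClasses X 1 → k3HilbertForm 2 (φ y) (φ d) = 0) →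
        f y = ∑ i : Fin n, ((a i : ℂ) • (e ^ (i : ℕ)) y))

/-- `CMX[X, φ, z]`: "`X` has complex multiplication" in marking coordinates — a rational endomorphism of
`H²(X(ℂ); ℂ)` preserving type `(1,1)` with a NON-REAL eigenvalue on `σ = φ⁻¹ z`. Local notation only. -/
local notation3 (prettyPrint := false) "CMX[" X ", " φ ", " z "]" =>
  (∃ Ψ : complexBetti X 2 →ₗ[ℂ] complexBetti X 2, (∀ y, IsRationalClass y → IsRationalClass (Ψ y)) ∧
    (∀ y, IsOfHodgeType 4 X 2 1 1 y → IsOfHodgeType 4 X 2 1 1 (Ψ y)) ∧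
    ∃ μ : ℂ, μ.im ≠ 0 ∧ Ψ (LinearEquiv.symm φ z) = μ • LinearEquiv.symm φ z)

/-- `qQ`: the rational Beauville–Bogomolov form on `ℚ²³`. -/
local notation3 (prettyPrint := false) "qQ" => Matrix.toBilin' (Matrix.map (k3HilbertGram 2) (Int.cast : ℤ → ℚ))

variable {X : SchemeOver ℂ} {φ : complexBetti X 2 ≃ₗ[ℂ] (K3HilbertIndex → ℂ)} {P : complexBetti X (2 * 4)}
  {z : K3HilbertIndex → ℂ}

/-! ### The engine -/

/-- **One cycle suffices on the `X` side — the engine.** For a marked smooth projective `K3^{[2]}`-type `X`, an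
eigenvalue `ev`, an abstract GENERATION CRITERION (for every irreducible polarized Hodge structure `H` of K3
type with `E = End_Hdg` a totally real field, `ε : E ↪ ℂ` the `(2,0)`-character, `r ∈ E` with `ε r = ev` and
`dim V + ρ(X) = 23`: `E = ℚ[r]`), and a rational type-preserving endomorphism `e` of `H²(X)` with
`e σ = ev · σ`: either `GenX[X, φ, e]` (the `hgen` of the `X`-side F4) or `ρ(X)` is odd and `CMX[X, φ, z]`.
Marking picture on
the period datum (`…K3Sq2PeriodDatum`, `…LatticeBridge*`): `e|_T ∈ E` (`restrict_mem_endAlg`) with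
`ε(e|_T) = ev`; if `E` is totally real the criterion gives `f|_T = P(e|_T)` for every Hodge `f`, read back on
`H²(X)`; otherwise Zarhin's adjoint theorem yields `a ∈ E` with `ε a ∉ ℝ`, extended by `id_N` (`extendT`).
[cite: Zarhin1983HodgeGroupsK3, Thm. 1.5.1 and Thm. 1.6] [cite: Huybrechts2016K3, Ch. 3 Lemma 3.3.1 and Thm. 3.3.7]
[cite: Vangeemen2008, Lemma 3.2] -/
theorem generatedBy_or_cm_of_criterion (hX : IsSmoothProjective 4 X) (hM : MarkedK3Sq[X, φ, P, z]) (ev : ℂ)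
    (hcrit : ∀ (V : Type) [AddCommGroup V] [Module ℚ V] [Module.Finite ℚ V] (H : HodgeStructure V 2),
      H.IsIrreducible → H.IsOfK3Type → H.Polarization → IsField H.endAlg →
      (∀ (φ' : H.endAlg →+* ℂ) (a : H.endAlg), starRingEnd ℂ (φ' a) = φ' a) →
      ∀ ε : H.endAlg →ₐ[ℚ] ℂ, Function.Injective ε → ∀ r : H.endAlg, ε r = ev →
      Module.finrank ℚ V + Module.finrank ℂ ↥(algebraicClasses X 1) = 23 →
      ∀ s : H.endAlg, ∃ p : Polynomial ℚ, s = aeval r p)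
    (e : complexBetti X 2 →ₗ[ℂ] complexBetti X 2) (he_rat : ∀ y, IsRationalClass y → IsRationalClass (e y))
    (he_typ : ∀ (i j : ℕ) y, IsOfHodgeType 4 X 2 i j y → IsOfHodgeType 4 X 2 i j (e y))
    (he_ev : e (φ.symm z) = ev • φ.symm z) :
    GenX[X, φ, e] ∨ (Odd (Module.finrank ℂ ↥(algebraicClasses X 1)) ∧ CMX[X, φ, z]) := by
  classical
  obtain ⟨-, hint, -, ⟨hz20, hz20'⟩, h11, hzz, hzpos⟩ := id hM
  obtain ⟨NQ, hNQ⟩ := exists_ratNeronSeveri (X := X) φ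
  set D := periodDatum hX hM hNQ with hDdef
  obtain ⟨hDT, hDN, hDx, -, hDBC⟩ := periodDatum_T hX hM hNQ
  have hzne : z ≠ 0 := by
    intro h0
    rw [h0, k3HilbertForm_eq_dotProduct] at hzpos
    simp at hzpos
  -- the transcendental Hodge structure of `X`, irreducible of K3 type, polarized; its endomorphism field
  set H := D.hodgeT with hH
  have hK3 : H.IsOfK3Type := D.isOfK3Type_hodgeT
  have hirr : H.IsIrreducible := D.isIrreducible_hodgeT
  set ψ : H.Polarization := D.polT with hψ
  obtain ⟨hFld, ε, hεinj, hε⟩ := Zarhin1983_endAlg_isField_holds H hirr hK3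
  have hω : D.omega ∈ H.piece 2 0 := D.omega_mem_piece
  -- reading a rational type-preserving endomorphism of `H²(X)` in `E = End_Hdg(T)`
  have read : ∀ (G : complexBetti X 2 →ₗ[ℂ] complexBetti X 2),
      (∀ y, IsRationalClass y → IsRationalClass (G y)) →
      (∀ (i j : ℕ) y, IsOfHodgeType 4 X 2 i j y → IsOfHodgeType 4 X 2 i j (G y)) →
      ∃ (τ : Module.End ℚ (K3HilbertIndex → ℚ)) (hτT : ∀ t ∈ D.T, τ t ∈ D.T),
        cxEnd τ = φ.toLinearMap ∘ₗ G ∘ₗ φ.symm.toLinearMap ∧ τ.restrict hτT ∈ H.endAlg := by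
    intro G hG_rat hG_typ
    obtain ⟨τ, hτM, hτx, hτ11⟩ := exists_ratEnd_of_hodgeEndomorphism hX hM G hG_rat hG_typ
    have hτx' : ∃ c : ℂ, cxEnd τ D.x = c • D.x := by rw [hDx]; exact hτx
    have hτ11' : ∀ w : K3HilbertIndex → ℂ, D.BC w D.x = 0 → D.BC w (star D.x) = 0 →
        D.BC (cxEnd τ w) D.x = 0 ∧ D.BC (cxEnd τ w) (star D.x) = 0 := by
      intro w h1 h2
      rw [hDBC, hDx] at h1 h2
      rw [hDBC, hDBC, hDx]
      exact hτ11 w h1 h2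
    have hτT : ∀ t ∈ D.T, τ t ∈ D.T := fun t ht => D.map_mem_T τ hτx' ht
    exact ⟨τ, hτT, hτM, D.restrict_mem_endAlg τ hτT hτx' hτ11'⟩
  obtain ⟨τe, hτeT, hτeM, hre⟩ := read e he_rat he_typ
  have hτeMapp : ∀ v, cxEnd τe v = φ (e (φ.symm v)) := fun v => by rw [hτeM]; rfl
  -- `ε(e|_T)` is the `(2,0)`-eigenvalue of `e`
  have hεre : ε ⟨τe.restrict hτeT, hre⟩ = ev := by
    have h := hε ⟨τe.restrict hτeT, hre⟩ D.omega hω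
    have h2 := congrArg (iota D.T) h
    have hval : ((⟨τe.restrict hτeT, hre⟩ : H.endAlg) : Module.End ℚ ↥D.T) = τe.restrict hτeT := rfl
    rw [hval, D.iota_baseChange_restrict τe hτeT, D.iota_omega, map_smul, D.iota_omega, hDx, hτeMapp, he_ev,
      map_smul, LinearEquiv.apply_symm_apply] at h2
    have h3 : (ev - ε ⟨τe.restrict hτeT, hre⟩) • z = 0 := by rw [sub_smul, h2, sub_self]
    rcases smul_eq_zero.1 h3 with h4 | h4
    · exact (sub_eq_zero.1 h4).symm
    · exact absurd h4 hzne
  -- `dim_ℚ T = 23 - ρ(X)`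
  have hdimT : Module.finrank ℚ ↥D.T + Module.finrank ℂ ↥(algebraicClasses X 1) = 23 := by
    have h := Submodule.finrank_add_eq_of_isCompl (isCompl_ratNeronSeveri_orthogonal hX hM hNQ)
    rw [finrank_ratNeronSeveri hX hint hNQ, finrank_rat23] at h
    rw [hDT]
    omega
  by_cases hreal : ∀ (φ' : H.endAlg →+* ℂ) (a : H.endAlg), starRingEnd ℂ (φ' a) = φ' a
  · -- `E` totally real: the criterion gives `E = ℚ[e|_T]`
    left
    intro f hf_rat hf_typ _ _
    obtain ⟨τf, hτfT, hτfM, hrf⟩ := read f hf_rat hf_typ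
    have hτfMapp : ∀ v, cxEnd τf v = φ (f (φ.symm v)) := fun v => by rw [hτfM]; rfl
    obtain ⟨p, hp⟩ := hcrit (↥D.T) H hirr hK3 ψ hFld hreal ε hεinj ⟨τe.restrict hτeT, hre⟩ hεre hdimT
      ⟨τf.restrict hτfT, hrf⟩
    -- `τf = p(τe)` on `T`
    have hTeq : ∀ t ∈ D.T, τf t = ∑ i ∈ Finset.range (p.natDegree + 1), p.coeff i • (τe ^ i) t := by
      intro t ht
      have h1 : (τf.restrict hτfT : Module.End ℚ ↥D.T) = aeval (τe.restrict hτeT) p := by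
        have h := congrArg Subtype.val hp
        rw [Polynomial.aeval_subalgebra_coe] at h
        exact h
      have h2 := congrArg Subtype.val (LinearMap.congr_fun h1 ⟨t, ht⟩)
      rw [LinearMap.coe_restrict_apply, Polynomial.aeval_eq_sum_range, LinearMap.sum_apply,
        Submodule.coe_sum] at h2
      rw [h2]
      refine Finset.sum_congr rfl fun i _ => ?_
      rw [LinearMap.smul_apply, Submodule.coe_smul, Module.End.pow_restrict i hτeT, LinearMap.coe_restrict_apply]
    -- complexify: `cxEnd τf = Σ cᵢ (cxEnd τe)ⁱ` on `T_ℂ`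
    have hpowφ : ∀ (i : ℕ) (y : complexBetti X 2), (cxEnd τe ^ i) (φ y) = φ ((e ^ i) y) := by
      intro i
      induction i with
      | zero => intro y; rw [pow_zero, pow_zero, Module.End.one_apply, Module.End.one_apply]
      | succ i ih =>
        intro y
        rw [pow_succ', pow_succ', Module.End.mul_apply, Module.End.mul_apply, ih, hτeMapp,
          LinearEquiv.symm_apply_apply]
    have hcx : ∀ w : ℂ ⊗[ℚ] ↥D.T,
        cxEnd τf (iota _ w) = ∑ i ∈ Finset.range (p.natDegree + 1),
          ((p.coeff i : ℚ) : ℂ) • (cxEnd τe ^ i) (iota _ w) := by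
      intro w
      induction w using TensorProduct.induction_on with
      | zero => simp only [map_zero, smul_zero, Finset.sum_const_zero]
      | tmul a t =>
        rw [iota_tmul, map_smul, cxEnd_ratVec, hTeq _ t.2, ratCastVec_sum, Finset.smul_sum]
        refine Finset.sum_congr rfl fun i _ => ?_
        rw [ratCastVec_smul, ← cxEnd_ratVec, cxEnd_pow, map_smul, smul_comm]
      | add z₁ z₂ h₁ h₂ =>
        rw [map_add, map_add, h₁, h₂, ← Finset.sum_add_distrib]
        refine Finset.sum_congr rfl fun i _ => ?_
        rw [map_add, smul_add]
    refine ⟨p.natDegree + 1, fun i => p.coeff i, fun y hy => ?_⟩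
    -- `φ y ∈ T_ℂ`
    have hyT : φ y ∈ Submodule.span ℂ (Set.range fun t : ↥D.T => fun i => (((t : K3HilbertIndex → ℚ) i : ℚ) : ℂ)) := by
      have h := (mem_span_ratTransc_iff hX hint hNQ (φ y)).2 hy
      rw [Set.image_eq_range] at h
      rw [hDT]
      exact h
    have hz : iota _ (lam D.isCompl (φ y)) = φ y := iota_lam_of_mem_span D.isCompl hyT
    have hfy : f y = φ.symm (cxEnd τf (φ y)) := by
      rw [hτfMapp, LinearEquiv.symm_apply_apply, LinearEquiv.symm_apply_apply]
    rw [hfy, ← hz, hcx, hz, map_sum, Finset.sum_range]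
    refine Finset.sum_congr rfl fun i _ => ?_
    rw [map_smul, hpowφ, LinearEquiv.symm_apply_apply]
  · -- CM: an element of `End_Hdg(T)` with a non-real eigenvalue on `ω`, extended by `id_N`
    right
    push Not at hreal
    obtain ⟨φ', a, hφ'a⟩ := hreal
    -- `dim_ℚ T` is even (at odd rank `E` is totally real, Huybrechts Rem. 3.3.14 (ii)), so `ρ(X)` is odd
    have hρodd : Odd (Module.finrank ℂ ↥(algebraicClasses X 1)) := by
      have hT : ¬ Odd (Module.finrank ℚ ↥D.T) := fun hoddT =>
        hφ'a (HodgeStructure.forall_conj_apply_eq_of_odd_finrank hirr hK3 ψ hoddT φ' a)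
      obtain ⟨r, hr⟩ := Nat.not_odd_iff_even.1 hT
      exact ⟨11 - r, by omega⟩
    refine ⟨hρodd, ?_⟩
    obtain ⟨hadjex, hadjconj⟩ := Zarhin1983_adjoint_eq_conj_holds H hirr hK3 ψ
    obtain ⟨a', ha'⟩ := hadjex a
    have hne : a' ≠ a := by
      intro h
      apply hφ'a
      have key := hadjconj a a' ha' φ'
      rw [h] at key
      exact key.symm
    set μ : ℂ := ε a with hμdef
    have hμ : μ.im ≠ 0 := by
      intro him
      apply hne
      apply hεinj
      have key := hadjconj a a' ha' ε.toRingHom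
      change ε a' = starRingEnd ℂ (ε a) at key
      rw [key, ← hμdef]
      exact Complex.conj_eq_iff_im.2 him
    have hamem : ((a : H.endAlg) : Module.End ℚ ↥D.T) ∈ H.endAlg := a.2
    set û : Module.End ℚ (K3HilbertIndex → ℚ) := D.extendT (a : Module.End ℚ ↥D.T) with hû
    have hûx : cxEnd û z = μ • z := by
      have h := hε a D.omega hω
      have h2 := congrArg (iota D.T) h
      rw [D.iota_baseChange, D.iota_omega, map_smul, D.iota_omega, hDx] at h2
      exact h2
    have hû11 : ∀ w : K3HilbertIndex → ℂ, k3HilbertForm 2 w z = 0 → k3HilbertForm 2 w (star z) = 0 →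
        k3HilbertForm 2 (cxEnd û w) z = 0 ∧ k3HilbertForm 2 (cxEnd û w) (star z) = 0 := by
      intro w h1 h2
      have h := D.BC_cxEnd_extendT hamem (z := w) (by rw [hDBC, hDx]; exact h1) (by rw [hDBC, hDx]; exact h2)
      rwa [hDBC, hDBC, hDx] at h
    let Ψ : complexBetti X 2 →ₗ[ℂ] complexBetti X 2 := φ.symm.toLinearMap ∘ₗ cxEnd û ∘ₗ φ.toLinearMap
    have hΨapp : ∀ y, Ψ y = φ.symm (cxEnd û (φ y)) := fun y => rfl
    have hrat : ∀ c, IsRationalClass c ↔ ∃ w : K3HilbertIndex → ℚ, φ c = fun i => (w i : ℂ) :=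
      isRationalClass_iff_of_markedSq hX hint
    have hΨrat : ∀ y, IsRationalClass y → IsRationalClass (Ψ y) := by
      intro y hy
      obtain ⟨w, hw⟩ := (hrat y).1 hy
      rw [hΨapp, hw, cxEnd_ratVec]
      exact (hrat _).2 ⟨û w, LinearEquiv.apply_symm_apply _ _⟩
    have hΨσ : Ψ (φ.symm z) = μ • φ.symm z := by rw [hΨapp, LinearEquiv.apply_symm_apply, hûx, map_smul]
    have hΨ11 : ∀ y, IsOfHodgeType 4 X 2 1 1 y → IsOfHodgeType 4 X 2 1 1 (Ψ y) := by
      intro y hy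
      obtain ⟨h1, h2⟩ := (h11 y).1 hy
      rw [hΨapp, h11, LinearEquiv.apply_symm_apply]
      exact hû11 (φ y) h1 h2
    exact ⟨Ψ, hΨrat, hΨ11, μ, hμ, hΨσ⟩

/-! ### The two instances: prime form and degree form -/

/-- **One cycle suffices on the `X` side, prime form.** For a marked smooth projective `K3^{[2]}`-type `X`
such that `d · m + ρ(X) = 23` with `d ≥ 2`, `m ≥ 3` forces `d` prime (AUTOMATIC at `ρ(X) ∈ {1, 2}`:
`22 = 2 · 11`, `21 = 3 · 7`; at `ρ(X) = 3` unless `d = 4`), and a rational type-preserving endomorphism `e`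
of `H²(X(ℂ); ℂ)` with `e σ = ev · σ` on `σ = φ⁻¹ z`, `ev ∉ ℚ`: either `GenX[X, φ, e]` or `CMX[X, φ, z]`
(`exists_eq_aeval_of_totallyReal`: `[E:ℚ]` prime and `e|_T ∉ ℚ` give `E = ℚ[e|_T]`).
[cite: Vangeemen2008, Lemma 3.2] [cite: Zarhin1983HodgeGroupsK3, Thm. 1.5.1] [cite: GeemenSchutt2023, §2.1] -/
theorem generatedBy_or_cm_of_eigenvalue (hX : IsSmoothProjective 4 X) (hM : MarkedK3Sq[X, φ, P, z])
    (hρ : ∀ d m : ℕ, 2 ≤ d → 3 ≤ m → d * m + Module.finrank ℂ ↥(algebraicClasses X 1) = 23 → d.Prime)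
    (e : complexBetti X 2 →ₗ[ℂ] complexBetti X 2) (he_rat : ∀ y, IsRationalClass y → IsRationalClass (e y))
    (he_typ : ∀ (i j : ℕ) y, IsOfHodgeType 4 X 2 i j y → IsOfHodgeType 4 X 2 i j (e y))
    {ev : ℂ} (he_ev : e (φ.symm z) = ev • φ.symm z) (hev : ∀ a : ℚ, (a : ℂ) ≠ ev) :
    GenX[X, φ, e] ∨ (Odd (Module.finrank ℂ ↥(algebraicClasses X 1)) ∧ CMX[X, φ, z]) := by
  refine generatedBy_or_cm_of_criterion hX hM ev ?_ e he_rat he_typ he_ev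
  intro V _ _ _ H hirr hK3 ψ hFld hreal ε _ r hr hdim s
  have hV : ∀ d m : ℕ, 2 ≤ d → 3 ≤ m → Module.finrank ℚ V = d * m → d.Prime :=
    fun d m hd hm h => hρ d m hd hm (by rw [← h]; exact hdim)
  have hr_bot : r ∉ (⊥ : Subalgebra ℚ H.endAlg) := by
    intro h
    rw [Algebra.mem_bot] at h
    obtain ⟨a, ha⟩ := h
    apply hev a
    rw [← hr, ← ha, AlgHom.commutes, eq_ratCast]
  exact OneCycle.exists_eq_aeval_of_totallyReal hirr hK3 ψ hFld hreal hV hr_bot s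

/-- **One cycle suffices on the `X` side, degree form.** As `generatedBy_or_cm_of_eigenvalue`, with the
eigenvalue `ev` algebraic of degree `k = deg minpoly_ℚ(ev)` and `k · j · m + ρ(X) ≠ 23` for `j ≥ 2`, `m ≥ 3`
(`exists_eq_aeval_of_totallyReal_of_natDegree_algHom`: `k ∣ [E:ℚ] ∣ 23 − ρ(X)` with cofactor `m ≥ 3` forces
`[E:ℚ] = k`, i.e. `E = ℚ[e|_T]`). E.g. `k = 3`, `ρ(X) = 2`: `21 = 3·7` admits no `3·j·m` with `j ≥ 2, m ≥ 3`.
[cite: Vangeemen2008, Lemma 3.2] [cite: Zarhin1983HodgeGroupsK3, Thm. 1.5.1] [cite: GeemenSchutt2023, §2.1] -/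
theorem generatedBy_or_cm_of_eigenvalue_natDegree (hX : IsSmoothProjective 4 X) (hM : MarkedK3Sq[X, φ, P, z])
    {k : ℕ} (hk : ∀ j m : ℕ, 2 ≤ j → 3 ≤ m → k * j * m + Module.finrank ℂ ↥(algebraicClasses X 1) ≠ 23)
    (e : complexBetti X 2 →ₗ[ℂ] complexBetti X 2) (he_rat : ∀ y, IsRationalClass y → IsRationalClass (e y))
    (he_typ : ∀ (i j : ℕ) y, IsOfHodgeType 4 X 2 i j y → IsOfHodgeType 4 X 2 i j (e y))
    {ev : ℂ} (he_ev : e (φ.symm z) = ev • φ.symm z) (hdeg : (minpoly ℚ ev).natDegree = k) :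
    GenX[X, φ, e] ∨ (Odd (Module.finrank ℂ ↥(algebraicClasses X 1)) ∧ CMX[X, φ, z]) := by
  refine generatedBy_or_cm_of_criterion hX hM ev ?_ e he_rat he_typ he_ev
  intro V _ _ _ H hirr hK3 ψ hFld hreal ε hεinj r hr hdim s
  have hV : ∀ j m : ℕ, 2 ≤ j → 3 ≤ m → Module.finrank ℚ V ≠ k * j * m :=
    fun j m hj hm h => hk j m hj hm (by rw [← h]; exact hdim)
  have hk' : (minpoly ℚ (ε r)).natDegree = k := by rw [hr]; exact hdeg
  exact OneCycle.exists_eq_aeval_of_totallyReal_of_natDegree_algHom hirr hK3 ψ hFld hreal ε hεinj hk' hV s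

end Summit.HodgeConjecture.HodgeConjecture.Theorems.MarkmanPartnerTransport.PartnerLattice

end
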